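/-
Copyright (c) 2026 the pub-hodgecm-mathlib formalisation cell (harness21).  Prover seat hodgecm-mathlib-LH4-p13 (g8), req620 Track A «(D-RAM) FOUR-FRAME» squad, tier 0,
STAGE-1b (dealer LH4-plan (g13) WORD #66 (3); LH4-p05 (g8) ★ p859970 №7 `CleanLabelDichotomyLawAt` (A″), producer LH4-p13): brick (L-lab-17b) «THE LEVEL ARITHMETIC OF THE
CLEAN SHELL ON THE HNF MODEL» — LEMMA Q (the third HNF exponent) and the exclusion of a lone cross entry on top, for the (GS) discharge (L-lab-17c).  2026-09-04.
-/
import Summits.HodgeConjecture.HodgeConjecture.Theorems.F0P3cDyRamHNFCrossGram              -- ★ (this seat, (L-lab-17a)): `cross_latt_hnf_expand`, `v_cross_le_of_latticeInLevel_of_integral`, `eq_of_le_of_gt_succ`,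
                                                                                          -- `exists_gram_gt_of_not_latticeInLevel`, `mulVec_hnf_apply`, `mulVec_three_mem_latt`, `exists_coords_shear₀∕₁`, `triple_A_values`, `triple_C_values`;
                                                                                          -- brings ★ p859653, ★ p859056, ★ `mulVec_hnf`, ★ `dualisable_strata`, `dualFrame_values`, `gram_values`, ★ `v_pow_eq_exp_neg`
import HarnessLib

/-!
# Crux `H413`, line LH4 «(D-RAM) FOUR-FRAME», STAGE-1b — (L-lab-17b) «THE LEVEL ARITHMETIC OF THE CLEAN SHELL ON THE HNF MODEL»

Cell `hodgecm-mathlib` (D-0151), FLOOR 0, crux item H413 = `stmt-HodgeConjecture-24833`, route of record `HCCMUnconditional`; squad F0∕P3c∕LH4.  THEOREMS ONLY (no `def`, no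
instance, no notation, no `sorry`, default heartbeats), ★-only imports, lane `--supports stmt-HodgeConjecture-24833`.

THE MATHEMATICS.  Normalised HNF lattice `L = V·𝒪³`, `V = [[1,0,0],[x,ϖ^b,0],[y,z,ϖ^c]]` (`x y z ∈ 𝒪`), self-dual for a `σ`-fixed non-degenerate `diag D`; `T = diag(α, β, 1)`,
`α, β ∈ E¹`, `X = diag(α−1, β−1, 0)`; `S(w, w′) = D₀σ(w₀)(α−1)w′₀ + D₁σ(w₁)(β−1)w′₁ = ⟨w, Xw′⟩_D`.  Columns `v⁰ = (1,x,y)`, `v¹ = (0,ϖ^b,z)`, `v² = (0,0,ϖ^c)`; S-Gram entries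
`A = S(v⁰,v⁰)`, `B = S(v⁰,v¹)`, `B′ = S(v¹,v⁰)`, `C = S(v¹,v¹)` (the `v²` row and column vanish).
* (★ (L-lab-17a) `F0P3cDyRamHNFCrossGram`: the S-Gram expansion, `|S| ≤ |ϖ^ℓ|`, «one entry above `|ϖ^{ℓ+1}|` off level `ℓ+1`», discreteness, the two Gram–Schmidt triples.)
* §3 `c_add_le_of_clean_shell` (LEMMA Q: `c + m + ℓ ≤ n₁ + n₂` from the 5th∕6th level inequalities, the 6th square-level inequality and normalisation at coordinate 2) and
  `not_cross_top` (the cross entry is never alone on top on the clean shell: it would force `n₃ = ℓ + b` and then `X²` at level `≤ 2ℓ`).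
* The HEAD «(GS) on the clean shell» is the sequel (L-lab-17c) `F0P3cDyRamHNFDiagonalTriple`.

HONEST LABEL: count-neutral; these are the (A″) engines on the HNF model; the transport to `CleanLabelDichotomyLawAt` (★ №7) is (L-lab-18).  HC_CM remains proved only modulo the printed
citations (2 remaining named inputs: hLiu418 = `stmt-HodgeConjecture-24832`, h413 = `stmt-HodgeConjecture-24833`) until rung 0 closes.
-/

noncomputable section

namespace Summit.HodgeConjecture.HodgeConjecture.Cruxes.H413.F0P3cDyRamHNFCleanShellArith

open Literature.NumberTheory.Automorphic Literature.NumberTheory.Automorphic.HermitianLattice Literature.NumberTheory.Automorphic.UnitaryGroup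
open Literature.NumberTheory.Automorphic.UnitaryLatticeTree Literature.NumberTheory.Automorphic.UnitaryThreeFourFrame
open Summit.HodgeConjecture.HodgeConjecture.Cruxes.H413.F0P3cDyRamFourFramePieces
open Summit.HodgeConjecture.HodgeConjecture.Cruxes.H413.F0P3cDyRamFourFrameCensusDefs
open Summit.HodgeConjecture.HodgeConjecture.Cruxes.H413.F0P3cDyRamDiagonalTorusDefs
open Summit.HodgeConjecture.HodgeConjecture.Cruxes.H413.F0P3cDyRamDiagonalStableLatticeHNF
open Summit.HodgeConjecture.HodgeConjecture.Cruxes.H413.F0P3cDyRamDiagonalHNFDualFrameValues (dualFrame_values gram_values)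
open Summit.HodgeConjecture.HodgeConjecture.Cruxes.H413.F0P3cDyRamDiagonalDualisableStrata (dualisable_strata)
open Summit.HodgeConjecture.HodgeConjecture.Cruxes.H413.F0P3cDyRamLevelTokenHNF (latticeInLevel_iff_forall_smul_mulVec_mem latticeInLevel_diagonal_latt_hnf_iff)
open Summit.HodgeConjecture.HodgeConjecture.Cruxes.H413.F0P3cDyRamUniformizerPowerTube (v_pow_eq_exp_neg)
open Summit.HodgeConjecture.HodgeConjecture.Cruxes.H413.F0P3cDyRamModelSquareLevelClean (pairing_diagonal_three smul_diagonal_mulVec_apply)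
open Summit.HodgeConjecture.HodgeConjecture.Cruxes.H413.F0P3cDyRamHNFCrossGram
open scoped Valued WithZero Matrix MatrixGroups
open WithZero

variable {K : Type} [Field K] [Valued K ℤᵐ⁰]

/-! ## §3  The level arithmetic on the clean shell: LEMMA Q and the exclusion of a lone cross entry on top -/

/-- **LEMMA Q — THE THIRD HNF EXPONENT ON THE CLEAN SHELL.**  For a normalised HNF lattice (`|y| = 1 ∨ |z| = 1 ∨ c = 0` — normalisation at the third coordinate) at level `ℓ`
(the 5th and 6th inequalities of ★ `latticeInLevel_diagonal_latt_hnf_iff` for `diag(α−1, β−1, 0)`) and square level `m_c` (the 6th inequality for `diag((α−1)², (β−1)², 0)`), with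
`|α−1| = |ϖ|^{n₂}`, `|β−1| = |ϖ|^{n₁}`, `m ≤ n₁, n₂`, `ℓ ≤ n₂` and `m + ℓ ≤ m_c`: `c + m + ℓ ≤ n₁ + n₂`.  (Ultrametric case analysis on `E₆ = −(α−1)yϖ^b + (α−β)xz` and on the square
expression `(α−1)E₆ + (β−1)(α−β)xz`.) [cite: Kottwitz1986BaseChangeUnits, §1 pp. 240–241] [cite: Serre1980Trees, Ch. II §1.1] -/
theorem c_add_le_of_clean_shell {ϖ : K} (hϖ : Valued.v ϖ = exp (-1 : ℤ)) {α β x y z : K} {b c ℓ mc m n₁ n₂ : ℕ}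
    (hn₂v : Valued.v (α - 1) = Valued.v ϖ ^ n₂) (hn₁v : Valued.v (β - 1) = Valued.v ϖ ^ n₁) (hnorm : Valued.v y = 1 ∨ Valued.v z = 1 ∨ c = 0)
    (h5 : Valued.v ((0 - (β - 1)) * z) ≤ Valued.v (ϖ ^ ℓ * ϖ ^ c))
    (h6 : Valued.v ((0 - (α - 1)) * y * ϖ ^ b + ((α - 1) - (β - 1)) * x * z) ≤ Valued.v (ϖ ^ ℓ * (ϖ ^ b * ϖ ^ c)))
    (hsq6 : Valued.v ((0 - (α - 1) * (α - 1)) * y * ϖ ^ b + ((α - 1) * (α - 1) - (β - 1) * (β - 1)) * x * z) ≤ Valued.v (ϖ ^ mc * (ϖ ^ b * ϖ ^ c)))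
    (hn₁ : m ≤ n₁) (hn₂ : m ≤ n₂) (hℓ : ℓ ≤ n₂) (hmc : m + ℓ ≤ mc) : c + m + ℓ ≤ n₁ + n₂ := by
  have hq : ∀ n : ℕ, Valued.v (ϖ ^ n) = exp (-(n : ℤ)) := v_pow_eq_exp_neg hϖ
  have hu : Valued.v (α - 1) = exp (-(n₂ : ℤ)) := by rw [hn₂v, ← map_pow, hq]
  have hw : Valued.v (β - 1) = exp (-(n₁ : ℤ)) := by rw [hn₁v, ← map_pow, hq]
  rcases hnorm with hy1 | hz1 | hc0
  · -- `|y| = 1`: split `P = (α−1)yϖ^b = Q′ − E₆`, `Q′ = (α−β)xz`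
    have hP : Valued.v ((α - 1) * y * ϖ ^ b) = exp (-(n₂ : ℤ) + -(b : ℤ)) := by rw [map_mul, map_mul, hu, hy1, hq, mul_one, ← exp_add]
    have hPeq : (α - 1) * y * ϖ ^ b = ((α - 1) - (β - 1)) * x * z - ((0 - (α - 1)) * y * ϖ ^ b + ((α - 1) - (β - 1)) * x * z) := by ring
    have hsplit : Valued.v ((α - 1) * y * ϖ ^ b) ≤
        max (Valued.v (((α - 1) - (β - 1)) * x * z)) (Valued.v ((0 - (α - 1)) * y * ϖ ^ b + ((α - 1) - (β - 1)) * x * z)) := by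
      rw [hPeq]; exact Valuation.map_sub _ _ _
    rcases le_max_iff.1 hsplit with hQ | hEP
    · -- `|P| ≤ |Q′|`: the square expression is `(α−1)·E₆ + (β−1)·Q′`
      have hid : (β - 1) * (((α - 1) - (β - 1)) * x * z) =
          ((0 - (α - 1) * (α - 1)) * y * ϖ ^ b + ((α - 1) * (α - 1) - (β - 1) * (β - 1)) * x * z) -
            (α - 1) * ((0 - (α - 1)) * y * ϖ ^ b + ((α - 1) - (β - 1)) * x * z) := by ring
      have hwQ : Valued.v ((β - 1) * (((α - 1) - (β - 1)) * x * z)) ≤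
          max (Valued.v ((0 - (α - 1) * (α - 1)) * y * ϖ ^ b + ((α - 1) * (α - 1) - (β - 1) * (β - 1)) * x * z))
            (Valued.v ((α - 1) * ((0 - (α - 1)) * y * ϖ ^ b + ((α - 1) - (β - 1)) * x * z))) := by
        rw [hid]; exact Valuation.map_sub _ _ _
      have hwQ_ge : exp (-(n₁ : ℤ) + (-(n₂ : ℤ) + -(b : ℤ))) ≤ Valued.v ((β - 1) * (((α - 1) - (β - 1)) * x * z)) := by
        rw [map_mul, hw, exp_add]
        exact mul_le_mul_right (hP.ge.trans hQ) _
      rcases le_max_iff.1 hwQ with h1 | h2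
      · have h := hwQ_ge.trans (h1.trans hsq6)
        rw [map_mul, map_mul, hq, hq, hq, ← exp_add, ← exp_add, exp_le_exp] at h
        omega
      · have huE : Valued.v ((α - 1) * ((0 - (α - 1)) * y * ϖ ^ b + ((α - 1) - (β - 1)) * x * z)) ≤ exp (-(n₂ : ℤ)) * Valued.v (ϖ ^ ℓ * (ϖ ^ b * ϖ ^ c)) := by
          rw [map_mul, hu]; exact mul_le_mul_right h6 _
        have h := hwQ_ge.trans (h2.trans huE)
        rw [map_mul, map_mul, hq, hq, hq, ← exp_add, ← exp_add, ← exp_add, exp_le_exp] at h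
        omega
    · -- `|P| ≤ |E₆| ≤ |ϖ^{ℓ+b+c}|`
      have h := (hP.ge.trans hEP).trans h6
      rw [map_mul, map_mul, hq, hq, hq, ← exp_add, ← exp_add, exp_le_exp] at h
      omega
  · -- `|z| = 1`: the 5th inequality
    have h := h5
    rw [map_mul, zero_sub, Valuation.map_neg, hw, hz1, mul_one, map_mul, hq, hq, ← exp_add, exp_le_exp] at h
    omega
  · omega


/-- **NO LONE CROSS ENTRY ON TOP.**  On a normalised `diag D`-self-dual HNF lattice at level `ℓ` with square level `m_c ≥ 2ℓ + 1` for an element datum with `n₁, n₂ ≥ ℓ + 1`, the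
cross entry `B′ = S(v¹, v⁰)` cannot have valuation `|ϖ^ℓ|` while `C = S(v¹, v¹)` is in `ϖ^{ℓ+1}` — it would force `b ≥ 1`, `|x| = 1`, `|z| = |ϖ|^{c+ℓ−n₁} < 1`, then (expanding `B′`
along `Xv⁰ = (α−1)v⁰ + β₁v¹ + γ₁v²` with integral Gram entries) `n₃ = ℓ + b`, and finally the square inequality would read `2ℓ ≥ m_c` or `ℓ ≥ n₂`.
[cite: Kottwitz1986BaseChangeUnits, §1 pp. 240–241] [cite: Jacobowitz1962, §4, §7] [cite: Serre1980Trees, Ch. II §1.1] -/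
theorem not_cross_top {σ : K →+* K} (hvσ : ∀ a, Valued.v (σ a) = Valued.v a) {ϖ : K} (hϖ : Valued.v ϖ = exp (-1 : ℤ))
    {D : Fin 3 → K} {α β x y z : K} {b c ℓ mc n₁ n₂ n₃ : ℕ}
    (hint : ∀ w ∈ latt (Matrix.of ![![1, 0, 0], ![x, ϖ ^ b, 0], ![y, z, ϖ ^ c]]), ∀ w' ∈ latt (Matrix.of ![![1, 0, 0], ![x, ϖ ^ b, 0], ![y, z, ϖ ^ c]]),
      Valued.v (pairing σ (Matrix.diagonal D) w w') ≤ 1)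
    (hD1 : Valued.v (D 1) = exp (b : ℤ) ∨ Valued.v (D 1) = Valued.v z * exp ((b : ℤ) + c)) (hD2 : Valued.v (D 2) = exp (c : ℤ)) (hx : Valued.v x ≤ 1) (hz : Valued.v z ≤ 1) (hbx : 1 ≤ b → Valued.v x = 1)
    (hn₂v : Valued.v (α - 1) = Valued.v ϖ ^ n₂) (hn₁v : Valued.v (β - 1) = Valued.v ϖ ^ n₁) (hn₃v : Valued.v (α - β) = Valued.v ϖ ^ n₃)
    (hn₁ : ℓ + 1 ≤ n₁) (hn₂ : ℓ + 1 ≤ n₂) (hmc : 2 * ℓ + 1 ≤ mc)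
    (h4 : Valued.v (((β - 1) - (α - 1)) * x) ≤ Valued.v (ϖ ^ ℓ * ϖ ^ b))
    (h6 : Valued.v ((0 - (α - 1)) * y * ϖ ^ b + ((α - 1) - (β - 1)) * x * z) ≤ Valued.v (ϖ ^ ℓ * (ϖ ^ b * ϖ ^ c)))
    (hsq6 : Valued.v ((0 - (α - 1) * (α - 1)) * y * ϖ ^ b + ((α - 1) * (α - 1) - (β - 1) * (β - 1)) * x * z) ≤ Valued.v (ϖ ^ mc * (ϖ ^ b * ϖ ^ c)))
    (hB' : Valued.v (D 1 * σ (ϖ ^ b) * ((β - 1) * x)) = Valued.v (ϖ ^ ℓ)) (hC : Valued.v (D 1 * σ (ϖ ^ b) * ((β - 1) * ϖ ^ b)) ≤ Valued.v (ϖ ^ (ℓ + 1))) :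
    False := by
  have hq : ∀ n : ℕ, Valued.v (ϖ ^ n) = exp (-(n : ℤ)) := v_pow_eq_exp_neg hϖ
  have hϖ0 : ϖ ≠ 0 := (Valuation.ne_zero_iff Valued.v).1 (by rw [hϖ]; exact exp_ne_zero)
  have hu : Valued.v (α - 1) = exp (-(n₂ : ℤ)) := by rw [hn₂v, ← map_pow, hq]
  have hw : Valued.v (β - 1) = exp (-(n₁ : ℤ)) := by rw [hn₁v, ← map_pow, hq]
  have h3 : Valued.v ((β - 1) - (α - 1)) = exp (-(n₃ : ℤ)) := by
    rw [show (β - 1) - (α - 1) = -(α - β) by ring, Valuation.map_neg, hn₃v, ← map_pow, hq]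
  -- (1) `b ≥ 1`, hence `|x| = 1`
  have hb : 1 ≤ b := by
    by_contra hb0
    have hb0' : b = 0 := by omega
    rw [hb0', pow_zero, mul_one, map_one, mul_one] at hC
    rw [hb0', pow_zero, map_one, mul_one] at hB'
    -- `|B′| = |D₁(β−1)|·|x| ≤ |D₁(β−1)| = |C|`
    have : Valued.v (ϖ ^ ℓ) ≤ Valued.v (ϖ ^ (ℓ + 1)) := by
      refine le_trans ?_ hC
      rw [← hB', show D 1 * ((β - 1) * x) = D 1 * (β - 1) * x by ring, Valuation.map_mul _ (D 1 * (β - 1)) x]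
      exact mul_le_of_le_one_right' hx
    rw [hq, hq, exp_le_exp] at this
    omega
  have hx1 : Valued.v x = 1 := hbx hb
  -- (2) `|D₁| = exp(b + n₁ − ℓ)` from `|B′| = |ϖ^ℓ|`
  have hD1v : Valued.v (D 1) = exp ((b : ℤ) + n₁ - ℓ) := by
    have h := hB'
    rw [map_mul, map_mul, map_mul, hvσ, hq, hw, hx1, mul_one, hq] at h
    -- `h : |D₁|·exp(−b)·exp(−n₁) = exp(−ℓ)`
    have hne : (exp (-(b : ℤ)) * exp (-(n₁ : ℤ)) : ℤᵐ⁰) ≠ 0 := mul_ne_zero exp_ne_zero exp_ne_zero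
    calc Valued.v (D 1) = Valued.v (D 1) * (exp (-(b : ℤ)) * exp (-(n₁ : ℤ))) * (exp (-(b : ℤ)) * exp (-(n₁ : ℤ)))⁻¹ := by
          rw [mul_inv_cancel_right₀ hne]
      _ = exp (-(ℓ : ℤ)) * (exp (-(b : ℤ)) * exp (-(n₁ : ℤ)))⁻¹ := by rw [← mul_assoc, h]
      _ = exp ((b : ℤ) + n₁ - ℓ) := by rw [← exp_add, ← exp_neg, ← exp_add]; congr 1; ring
  -- (3) `|z| = exp(n₁ − ℓ − c)`, and `|z| < 1`
  have hzv : Valued.v z = exp ((n₁ : ℤ) - ℓ - c) := by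
    rcases hD1 with h | h
    · rw [hD1v, exp_inj] at h; omega
    · rw [hD1v] at h
      have hne : (exp ((b : ℤ) + c) : ℤᵐ⁰) ≠ 0 := exp_ne_zero
      calc Valued.v z = Valued.v z * exp ((b : ℤ) + c) * (exp ((b : ℤ) + c))⁻¹ := by rw [mul_inv_cancel_right₀ hne]
        _ = exp ((n₁ : ℤ) - ℓ - c) := by rw [← h, ← exp_neg, ← exp_add]; congr 1; ring
  have hzlt : (n₁ : ℤ) - ℓ - c < 0 := by
    -- if `|z| = 1` the Gram entry `G₁₁ = D₁N(ϖ^b) + D₂N(z)` would have valuation `exp c > 1`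
    have hle : (n₁ : ℤ) - ℓ - c ≤ 0 := by
      have h := hz; rw [hzv, ← exp_zero, exp_le_exp] at h; exact h
    rcases hle.lt_or_eq with hlt | heq
    · exact hlt
    · exfalso
      have hv1 : (Matrix.of ![![1, 0, 0], ![x, ϖ ^ b, 0], ![y, z, ϖ ^ c]]) *ᵥ ![0, 1, 0] ∈ latt (Matrix.of ![![1, 0, 0], ![x, ϖ ^ b, 0], ![y, z, ϖ ^ c]]) :=
        mulVec_three_mem_latt _ (by simp) (by simp) (by simp)
      have hG := hint _ hv1 _ hv1
      obtain ⟨h10, h11, h12⟩ := mulVec_hnf_apply x y z (ϖ ^ b) (ϖ ^ c) (0 : K) 1 0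
      rw [pairing_diagonal_three, h10, h11, h12] at hG
      simp only [mul_zero, mul_one, add_zero, zero_add, map_zero, zero_mul] at hG
      -- `hG : |σ(ϖ^b)·D₁·ϖ^b + σz·D₂·z| ≤ 1`, the two terms have valuations `exp(n₁ − ℓ − b) = exp(c − b)` and `exp c`
      have hA1 : Valued.v (σ (ϖ ^ b) * D 1 * ϖ ^ b) = exp ((c : ℤ) - b) := by
        rw [map_mul, map_mul, hvσ, hq, hD1v, ← exp_add, ← exp_add]; congr 1; omega
      have hA2 : Valued.v (σ z * D 2 * z) = exp (c : ℤ) := by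
        rw [map_mul, map_mul, hvσ, hzv, hD2, heq, ← exp_add, ← exp_add]; congr 1; ring
      have hlt' : Valued.v (σ (ϖ ^ b) * D 1 * ϖ ^ b) < Valued.v (σ z * D 2 * z) := by rw [hA1, hA2, exp_lt_exp]; omega
      have hsum : Valued.v (σ (ϖ ^ b) * D 1 * ϖ ^ b + σ z * D 2 * z) = exp (c : ℤ) := by rw [Valuation.map_add_eq_of_lt_right _ hlt', hA2]
      rw [hsum, ← exp_zero, exp_le_exp] at hG
      omega
  -- (4) the expansion of `B′` along `Xv⁰ = (α−1)v⁰ + β₁v¹ + γ₁v²`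
  set β₁ : K := ((β - 1) - (α - 1)) * x / ϖ ^ b with hβ₁
  set γ₁ : K := -((α - 1) * y + β₁ * z) / ϖ ^ c with hγ₁
  have hϖb : (ϖ ^ b : K) ≠ 0 := pow_ne_zero _ hϖ0
  have hϖc : (ϖ ^ c : K) ≠ 0 := pow_ne_zero _ hϖ0
  have hexp : D 1 * σ (ϖ ^ b) * ((β - 1) * x) =
      (α - 1) * (σ (ϖ ^ b) * D 1 * x + σ z * D 2 * y) + β₁ * (σ (ϖ ^ b) * D 1 * ϖ ^ b + σ z * D 2 * z) + γ₁ * (σ z * D 2 * ϖ ^ c) := by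
    rw [hγ₁, hβ₁]
    field_simp
    ring
  -- the Gram entries `G₁₀`, `G₁₁` are integral
  have hv0 : (Matrix.of ![![1, 0, 0], ![x, ϖ ^ b, 0], ![y, z, ϖ ^ c]]) *ᵥ ![1, 0, 0] ∈ latt (Matrix.of ![![1, 0, 0], ![x, ϖ ^ b, 0], ![y, z, ϖ ^ c]]) :=
    mulVec_three_mem_latt _ (by simp) (by simp) (by simp)
  have hv1 : (Matrix.of ![![1, 0, 0], ![x, ϖ ^ b, 0], ![y, z, ϖ ^ c]]) *ᵥ ![0, 1, 0] ∈ latt (Matrix.of ![![1, 0, 0], ![x, ϖ ^ b, 0], ![y, z, ϖ ^ c]]) :=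
    mulVec_three_mem_latt _ (by simp) (by simp) (by simp)
  have hG10 : Valued.v (σ (ϖ ^ b) * D 1 * x + σ z * D 2 * y) ≤ 1 := by
    have h := hint _ hv1 _ hv0
    obtain ⟨h10, h11, h12⟩ := mulVec_hnf_apply x y z (ϖ ^ b) (ϖ ^ c) (0 : K) 1 0
    obtain ⟨h00, h01, h02⟩ := mulVec_hnf_apply x y z (ϖ ^ b) (ϖ ^ c) (1 : K) 0 0
    rw [pairing_diagonal_three, h10, h11, h12, h00, h01, h02] at h
    simpa using h
  have hG11 : Valued.v (σ (ϖ ^ b) * D 1 * ϖ ^ b + σ z * D 2 * z) ≤ 1 := by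
    have h := hint _ hv1 _ hv1
    obtain ⟨h10, h11, h12⟩ := mulVec_hnf_apply x y z (ϖ ^ b) (ϖ ^ c) (0 : K) 1 0
    rw [pairing_diagonal_three, h10, h11, h12] at h
    simpa using h
  -- valuations of `β₁`, `γ₁`
  have hβ₁le : Valued.v β₁ ≤ exp (-(ℓ : ℤ)) := by
    rw [hβ₁, map_div₀, div_le_iff₀ (zero_lt_iff.2 ((Valuation.ne_zero_iff _).2 hϖb)), ← hq, ← map_mul]
    exact h4
  have hβ₁v : Valued.v β₁ = exp (-(n₃ : ℤ) + b) := by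
    rw [hβ₁, map_div₀, map_mul, h3, hx1, mul_one, hq, div_eq_iff (exp_ne_zero), ← exp_add]; congr 1; ring
  have hγ₁le : Valued.v γ₁ ≤ exp (-(ℓ : ℤ)) := by
    have hE : γ₁ * (ϖ ^ b * ϖ ^ c) = (0 - (α - 1)) * y * ϖ ^ b + ((α - 1) - (β - 1)) * x * z := by rw [hγ₁, hβ₁]; field_simp; ring
    have h := h6
    rw [← hE, Valuation.map_mul _ γ₁, Valuation.map_mul _ (ϖ ^ ℓ)] at h
    have hpos : 0 < Valued.v (ϖ ^ b * ϖ ^ c) := zero_lt_iff.2 ((Valuation.ne_zero_iff _).2 (mul_ne_zero hϖb hϖc))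
    rw [← hq]
    exact le_of_mul_le_mul_right h hpos
  -- (5) `|β₁| = exp(−ℓ)`, i.e. `n₃ = ℓ + b`
  have hn₃ : (n₃ : ℤ) = ℓ + b := by
    have hle : -(n₃ : ℤ) + b ≤ -ℓ := by rw [← exp_le_exp, ← hβ₁v]; exact hβ₁le
    -- the other direction from `|B′| = exp(−ℓ)` and the expansion
    have hB'v : Valued.v (D 1 * σ (ϖ ^ b) * ((β - 1) * x)) = exp (-(ℓ : ℤ)) := by rw [hB', hq]
    rw [hexp] at hB'v
    have ht1 : Valued.v ((α - 1) * (σ (ϖ ^ b) * D 1 * x + σ z * D 2 * y)) < exp (-(ℓ : ℤ)) := by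
      rw [map_mul, hu]
      calc exp (-(n₂ : ℤ)) * Valued.v (σ (ϖ ^ b) * D 1 * x + σ z * D 2 * y) ≤ exp (-(n₂ : ℤ)) * 1 := mul_le_mul_right hG10 _
        _ < exp (-(ℓ : ℤ)) := by rw [mul_one, exp_lt_exp]; omega
    have ht3 : Valued.v (γ₁ * (σ z * D 2 * ϖ ^ c)) < exp (-(ℓ : ℤ)) := by
      rw [map_mul, map_mul, map_mul, hvσ, hzv, hD2, hq]
      calc Valued.v γ₁ * (exp ((n₁ : ℤ) - ℓ - c) * exp (c : ℤ) * exp (-(c : ℤ))) ≤ exp (-(ℓ : ℤ)) * (exp ((n₁ : ℤ) - ℓ - c) * exp (c : ℤ) * exp (-(c : ℤ))) :=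
            mul_le_mul_left hγ₁le _
        _ < exp (-(ℓ : ℤ)) := by rw [← exp_add, ← exp_add, ← exp_add, exp_lt_exp]; omega
    by_contra hne
    have hlt2 : Valued.v (β₁ * (σ (ϖ ^ b) * D 1 * ϖ ^ b + σ z * D 2 * z)) < exp (-(ℓ : ℤ)) := by
      rw [map_mul, hβ₁v]
      calc exp (-(n₃ : ℤ) + b) * Valued.v (σ (ϖ ^ b) * D 1 * ϖ ^ b + σ z * D 2 * z) ≤ exp (-(n₃ : ℤ) + b) * 1 := mul_le_mul_right hG11 _
        _ < exp (-(ℓ : ℤ)) := by rw [mul_one, exp_lt_exp]; omega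
    have hsum := (Valuation.map_add_lt _ (Valuation.map_add_lt _ ht1 hlt2) ht3)
    exact (lt_irrefl _) (hB'v ▸ hsum)
  -- (6) the square inequality: `(β−1)·Q′ = E_sq − (α−1)·E₆` with `|(β−1)Q′| = exp(−(2ℓ + b + c))`
  have hQv : Valued.v ((β - 1) * (((α - 1) - (β - 1)) * x * z)) = exp (-((2 * ℓ + b + c : ℕ) : ℤ)) := by
    rw [map_mul, map_mul, map_mul, hw, show (α - 1) - (β - 1) = -((β - 1) - (α - 1)) by ring, Valuation.map_neg, h3, hx1, hzv, mul_one,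
      ← exp_add, ← exp_add]
    congr 1; push_cast; omega
  have hid : (β - 1) * (((α - 1) - (β - 1)) * x * z) =
      ((0 - (α - 1) * (α - 1)) * y * ϖ ^ b + ((α - 1) * (α - 1) - (β - 1) * (β - 1)) * x * z) -
        (α - 1) * ((0 - (α - 1)) * y * ϖ ^ b + ((α - 1) - (β - 1)) * x * z) := by ring
  have hwQ : Valued.v ((β - 1) * (((α - 1) - (β - 1)) * x * z)) ≤
      max (Valued.v ((0 - (α - 1) * (α - 1)) * y * ϖ ^ b + ((α - 1) * (α - 1) - (β - 1) * (β - 1)) * x * z))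
        (Valued.v ((α - 1) * ((0 - (α - 1)) * y * ϖ ^ b + ((α - 1) - (β - 1)) * x * z))) := by
    rw [hid]; exact Valuation.map_sub _ _ _
  rw [hQv] at hwQ
  rcases le_max_iff.1 hwQ with h1 | h2
  · have h := h1.trans hsq6
    rw [map_mul, map_mul, hq, hq, hq, ← exp_add, ← exp_add, exp_le_exp] at h
    omega
  · have huE : Valued.v ((α - 1) * ((0 - (α - 1)) * y * ϖ ^ b + ((α - 1) - (β - 1)) * x * z)) ≤ exp (-(n₂ : ℤ)) * Valued.v (ϖ ^ ℓ * (ϖ ^ b * ϖ ^ c)) := by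
      rw [map_mul, hu]; exact mul_le_mul_right h6 _
    have h := h2.trans huE
    rw [map_mul, map_mul, hq, hq, hq, ← exp_add, ← exp_add, ← exp_add, exp_le_exp] at h
    omega


end Summit.HodgeConjecture.HodgeConjecture.Cruxes.H413.F0P3cDyRamHNFCleanShellArith

end
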